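import Literature.MathematicalPhysics.QuantumFieldTheory.Balaban1983to89.B16RLeafRecord13Live
import Literature.MathematicalPhysics.QuantumFieldTheory.Balaban1983to89.Node00.Record12BgRowAnalysis
import Literature.MathematicalPhysics.QuantumFieldTheory.Balaban1983to89.Node00.Record13NumericsOfThm1C

/-!
# `Balaban1983to89.B14SeparationOfRecord` — [III] (2.1), p. 256, (3.5): EVERY SEQUENCE OF REGIONS CHARGED BY A DENSITY OF RECORD IS ADMISSIBLE WITH
# SEPARATED BOUNDARIES — the large-field region `Ω_{j+1}` produced by node00-def-T's index map (3.5) keeps THREE LAYERS OF 𝐃_{j+1}-CUBES inside `Λ_j`,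
# and a sequence the index map does not produce carries the zero slot at every later level
# ([Balaban1988Convergent] (2.1) p. 254, p. 256 «the distance between their boundaries is at least equal to 2MR_j», (3.2)–(3.5) p. 265, (3.20) p. 269)

statement-level bookkeeping over published theorems with citation tags; combinatorial geometry and empty-sum bookkeeping over node00-def-T's definitions
(`Node00/StepWeightsOfRecord`, `Node00/RepTowerOfRecord`); nothing here is a claim about the Yang–Mills mass gap.

WHAT THIS FILE RECORDS (seat dag-n11-e g6; dag-lead WORDS-138 (4) ∕ plan WORD-136 (3)(A): the LOCATED range difference «the tree's (2.18) index
`SeqOfRecord` carries only the nesting `Λ_j ⊆ Ω_j`, `Ω_{j+1} ⊆ Λ_j` — print's admissible sequences are SEPARATED» has its home on the REPRESENTATION side).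
The (2.18) sum of record ranges over ALL nested sequences, but the slots are generated by the 𝐓-step (†) with node00-def-T's RESUMMED weights
`wOfRecord A₁ ζ = Σ_{t : σ (init s′) t = s′} ω (init s′) t` along the index map `σOfRecord` of (3.5)∕(3.20), and by def-R's 𝐑-step.  Hence:

§1  TORUS COLLAR LEMMA `mem_cubeEnl_of_meet`: if the `n`-collar of the `s`-cube `a` meets the `s`-cube `b`, the `m`-collar of `a` lies in the `(n+m+1)`-collar of
    `b` (universal cover + deck translation `cover_eq_cover_iff`; NO divisibility hypothesis, whence the `+1`); membership readers for def-T's `hullD` ∕ `fillD`.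
§2  ★ GEOMETRY OF (3.5): `hullD_OmegaOfLabel_subset_Λ` — for `k ≥ 1`, THREE LAYERS of 𝐃_{k+1}-cubes around `Ω_{k+1}(t)` stay inside `Λ_k` (⊆ `Ω_k`): `Ω_{k+1}(t)`
    lies in the (3.2) window `(Z̃_k^{∼4})ᶜ`, `Z_k = Λ_kᶜ`, and a 𝐃-cube within three layers of `Ω_{k+1}(t)` meeting `Λ_kᶜ` would put a cube of `Ω_{k+1}(t)` within
    four layers of `Z̃_k`.  Print: «dist ≥ 2MR_j»; the record's construction gives `3·LMR_{k+1}` (fine-lattice side `sideD`).  The σ-image form.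
§3  SUPPORT OF THE RESUMMED WEIGHTS: `wOfRecord_eq_zero_of_forall_σ_ne` (a sequence NOT of the form `σ (init s′) t` has weight `0` — empty fibre); the
    𝐓-slot of such a sequence, and of any sequence whose parent slot is `0`, is identically `0` (`integral_zero` through the kernel transport); the post-𝐑 slot
    follows (def-R's `rstepSlotOfRecord_eq_zero_of_eq_zero`, ANY selector, NO proviso); so a PRESENT post-𝐑 slot at level `k+1` has a label `t` with
    `σ (init s′) t = s′` and a present parent.
§4  ★★ `separated_of_slotsOfRecord_ne_zero`: EVERY SEQUENCE WITH A NON-ZERO POST-𝐑 SLOT OF RECORD AT LEVEL `k` IS SEPARATED AT EVERY CONSECUTIVE PAIR —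
    `∀ j, 1 ≤ j < k → hullD (sideD … j) 3 (Ω_{j+1}) ⊆ Λ_j` (induction over the history); the same for the pre-𝐑 slots; POINTWISE, proviso-free, selector-generic,
    for every `E`, `A₁`, `ζ`, run and coupling history.
§5  The faces at node00-def-T's Stage-13 record (`EOfRecord₁₃`, `wOfRecord₉`, `θ.ppSel`, `gOfRecord₁₃`) BY NAME.

§6  (v1.1) THE BRIDGE to node00-def-P11's `Sect2.SeqSeparated ν.M₁ s` (ONE layer of `L^{n+1}M₁`-cubes, r11's `enl` on the cover): `enlT_one_subset_hullD_three`
    (r11's one `σ₁`-layer ⊆ def-T's three `σD`-layers when `σ₁ ≤ σD`) and ★★ `seqSeparated_of_slotsOfRecord_ne_zero` — every charged sequence is print-separated in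
    def-P11's predicate under the displayed grid comparison `0 < L^{j+1}M₁ ≤ L^{j+1}·M·R_{j+1}`; Stage-13 face; §6b the comparison DISCHARGED from
    `0 < M₁ ≤ M` (`one_le_RkOfRecord`) — CLOSED at `theta13LiveOfRecord`, `theta13OfThm1`, `theta13OfThm1C` (`M₁ = M = 1`).

HONEST SCOPE: nothing of Bałaban's estimates is asserted; the χ-side of the located difference is untouched (`chiSeqOfRecord` reads `Ω_k`
alone, plan (A)); count-neutral.
-/

noncomputable section

open MeasureTheory
open scoped BigOperators

namespace Literature.MathematicalPhysics.QuantumFieldTheory.Balaban1983to89.B14SeparationOfRecord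

open T4Continuum Node00 B14.Eq218Concrete B14.Eq213MaximalDomains B15Eq112TorusCover B15LatticeCubeTorus B14DomainGeom
open B16RLeafRecord12 (rstepSlotOfRecord_eq_zero_of_eq_zero)

/-! ## §1  The torus collar lemma and membership readers for `hullD` ∕ `fillD` -/

section Collar

variable {P : Params} {s : ℕ}

/-- Interval bookkeeping behind the torus collar lemma: a cover representative shifted by the deck translation that identifies the two readings of the
meeting point stays in the enlarged collar. [folklore] -/
private theorem collar_bound {S A B z₁ z₂ z₃ Nv cn cm : ℤ} (h1l : A - cn ≤ z₁) (h1u : z₁ ≤ A + S - 1 + cn)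
    (h2l : B ≤ z₂) (h2u : z₂ ≤ B + S - 1) (h3l : A - cm ≤ z₃) (h3u : z₃ ≤ A + S - 1 + cm) (hv : z₁ = z₂ + Nv) :
    B - (cn + cm + S) ≤ z₃ - Nv ∧ z₃ - Nv ≤ B + S - 1 + (cn + cm + S) := by
  constructor <;> linarith

/-- **TORUS COLLAR LEMMA**: if a point of the `s`-cube `b` lies within `n` layers of the `s`-cube `a`, then every point within `m` layers of `a` lies within
`n + m + 1` layers of `b` (cover representatives differ by a deck translation; the extra layer absorbs the missing grid alignment — no divisibility is used).
[cite: Balaban1988Convergent, (2.16)–(2.17) p.257, p.264–265 (the layer calculus «surrounded by n layers of such cubes»)] -/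
theorem mem_cubeEnl_of_meet {a b : Pt P.d} {n m : ℕ} {x y : Site P 0} (hy : y ∈ cubeEnl P s a n) (hyb : y ∈ cubeEnl P s b 0)
    (hx : x ∈ cubeEnl P s a m) : x ∈ cubeEnl P s b (n + m + 1) := by
  obtain ⟨z₁, hz₁, rfl⟩ := hy
  obtain ⟨z₂, hz₂, hz₂y⟩ := hyb
  obtain ⟨z₃, hz₃, rfl⟩ := hx
  obtain ⟨v, hv⟩ := (cover_eq_cover_iff z₂ z₁).1 hz₂y
  refine ⟨z₃ - pmul (per P) v, fun i => ?_, ?_⟩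
  · have h1 := hz₁ i
    have h2 := hz₂ i
    have h3 := hz₃ i
    have hvi : z₁ i = z₂ i + pmul (per P) v i := by rw [hv]; rfl
    have hcast : ((((n + m + 1) * s : ℕ)) : ℤ) = ((n * s : ℕ) : ℤ) + ((m * s : ℕ) : ℤ) + (s : ℤ) := by push_cast; ring
    simp only [Nat.zero_mul, Nat.cast_zero, sub_zero, add_zero] at h2
    rw [hcast, Pi.sub_apply]
    exact collar_bound h1.1 h1.2 h2.1 h2.2 h3.1 h3.2 hvi
  · have h := cover_add_pmul (z₃ - pmul (per P) v) v
    rw [sub_add_cancel] at h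
    exact h.symm

/-- Membership in def-T's `hullD P s n X`: a grid index whose `n`-collar meets `X` and whose cube contains the point. [cite: Balaban1988Convergent, p.264–265 (bookkeeping)] -/
theorem mem_hullD_iff {n : ℕ} {X : Set (Site P 0)} {x : Site P 0} :
    x ∈ hullD P s n X ↔ ∃ a ∈ cubeIndices P s, (cubeEnl P s a n ∩ X).Nonempty ∧ x ∈ cubeEnl P s a 0 := by
  classical
  unfold hullD
  constructor
  · intro h
    obtain ⟨a, ha, hx⟩ := Set.mem_iUnion₂.1 h
    exact ⟨a, (Finset.mem_filter.1 ha).1, (Finset.mem_filter.1 ha).2, hx⟩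
  · rintro ⟨a, ha, hne, hx⟩
    exact Set.mem_iUnion₂.2 ⟨a, Finset.mem_filter.2 ⟨ha, hne⟩, hx⟩

/-- Membership in def-T's `fillD P s X`: a grid index whose cube lies in `X` and contains the point. [cite: Balaban1988Convergent, (2.1) p.254 (bookkeeping)] -/
theorem mem_fillD_iff {X : Set (Site P 0)} {x : Site P 0} :
    x ∈ fillD P s X ↔ ∃ a ∈ cubeIndices P s, cubeEnl P s a 0 ⊆ X ∧ x ∈ cubeEnl P s a 0 := by
  classical
  unfold fillD
  constructor
  · intro h
    obtain ⟨a, ha, hx⟩ := Set.mem_iUnion₂.1 h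
    exact ⟨a, (Finset.mem_filter.1 ha).1, (Finset.mem_filter.1 ha).2, hx⟩
  · rintro ⟨a, ha, hsub, hx⟩
    exact Set.mem_iUnion₂.2 ⟨a, Finset.mem_filter.2 ⟨ha, hsub⟩, hx⟩

/-- **LAYER PROPAGATION**: if a point of `hullD P s n X` lies in the grid cube `b`, then the cube `b` lies inside `hullD P s (n+1) X` — one more layer absorbs the
step from a neighbouring cube. [cite: Balaban1988Convergent, p.264–265 (bookkeeping)] -/
theorem cubeEnl_subset_hullD_succ {n : ℕ} {X : Set (Site P 0)} {y : Site P 0} {b : Pt P.d} (hb : b ∈ cubeIndices P s)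
    (hy : y ∈ hullD P s n X) (hyb : y ∈ cubeEnl P s b 0) : cubeEnl P s b 0 ⊆ hullD P s (n + 1) X := by
  obtain ⟨a, -, ⟨z, hza, hzX⟩, hya⟩ := mem_hullD_iff.1 hy
  intro x hx
  refine mem_hullD_iff.2 ⟨b, hb, ⟨z, ?_, hzX⟩, hx⟩
  have := mem_cubeEnl_of_meet (n := 0) (m := n) hya hyb hza
  simpa [Nat.add_comm] using this

end Collar

/-! ## §2  ★ Geometry of the (3.5) index map: three 𝐃_{k+1}-layers around `Ω_{k+1}(t)` stay inside `Λ_k` -/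

section Geometry

variable (F : T4Family) (ν : Stage7Numerics) (M : ℕ) (p : B12.RunParams) (g : ℕ → ℝ) {k : ℕ}

/-- **★ THE NEW LARGE-FIELD REGION KEEPS THREE 𝐃_{k+1}-LAYERS INSIDE `Λ_k`** (`k ≥ 1`): for every old sequence `s` and label `t = (P, Q, R, S)_{k+1}`,
`hullD (sideD … k) 3 (Ω_{k+1}(t)) ⊆ Λ_k` — because `Ω_{k+1}(t) ⊆ guardΩ ⊆ (Z̃_k^{∼4})ᶜ` with `Z̃_k^{∼4} = hullD 4 (hullD 0 (Λ_kᶜ))` ((3.2) window, p. 265), and a 𝐃-cube within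
three layers of `Ω_{k+1}(t)` that meets `Λ_kᶜ` would place a cube of `Ω_{k+1}(t)` within four layers of `Z̃_k` (§1).  Print's admissibility «the distance between
their boundaries is at least equal to 2MR_j» in the record's stronger form `3·LMR_{k+1}`. [cite: Balaban1988Convergent, (2.1) p.254, p.256, (3.2)–(3.5) p.265, p.264] -/
theorem hullD_OmegaOfLabel_subset_Λ (hk : 1 ≤ k) (s : SeqOfRecord F ν M g p.K k) (t : LbOfRecord F ν p g k) :
    hullD (F.P p.K) (sideD F ν M p g k) 3 (OmegaOfLabel F ν M p g k s t) ⊆ s.Λ k := by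
  intro x hx
  obtain ⟨a, ha, ⟨y, hya, hyΩ⟩, hxa⟩ := mem_hullD_iff.1 hx
  have hyG : y ∈ guardΩ F ν M p g k s t.1 := OmegaOfLabel_subset_guard F ν M p g k s t hyΩ
  have hyW : y ∈ W32 F ν M p g k s := hyG.1.2
  have hyW' : y ∉ Ztilde4 F ν M p g k s := hyW
  have hyΩ' : y ∈ fillD (F.P p.K) (sideD F ν M p g k)
      (Omega0 F ν M p g k s t.1 t.2.1 ∩ guardΩ F ν M p g k s t.1) := hyΩ
  obtain ⟨b, hb, -, hyb⟩ := mem_fillD_iff.1 hyΩ'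
  by_contra hxΛ
  have hxZ : x ∈ Zreg F ν M p g k s := by
    rw [Zreg, if_pos hk]
    exact hxΛ
  have hxH : x ∈ hullD (F.P p.K) (sideD F ν M p g k) 0 (Zreg F ν M p g k s) :=
    mem_hullD_iff.2 ⟨a, ha, ⟨x, hxa, hxZ⟩, hxa⟩
  have hxb : x ∈ cubeEnl (F.P p.K) (sideD F ν M p g k) b 4 := by
    simpa using mem_cubeEnl_of_meet (n := 3) (m := 0) hya hyb hxa
  have hyZ : y ∈ hullD (F.P p.K) (sideD F ν M p g k) 4 (hullD (F.P p.K) (sideD F ν M p g k) 0 (Zreg F ν M p g k s)) :=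
    mem_hullD_iff.2 ⟨b, hb, ⟨x, hxb, hxH⟩, hyb⟩
  exact hyW' hyZ

/-- **… hence inside `Ω_k`** (`Λ_k ⊆ Ω_k`, (2.1)). [cite: Balaban1988Convergent, (2.1) p.254, p.256, (3.5) p.265] -/
theorem hullD_OmegaOfLabel_subset_Ω (hk : 1 ≤ k) (s : SeqOfRecord F ν M g p.K k) (t : LbOfRecord F ν p g k) :
    hullD (F.P p.K) (sideD F ν M p g k) 3 (OmegaOfLabel F ν M p g k s t) ⊆ s.Ω k :=
  (hullD_OmegaOfLabel_subset_Λ F ν M p g hk s t).trans (s.chain.Λ_subset k hk le_rfl)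

/-- **The new small-field region too**: `hullD … 3 (Λ_{k+1}(t)) ⊆ hullD … 3 (Ω_{k+1}(t)) ⊆ Λ_k` is immediate from `Λ_{k+1}(t) ⊆ Ω_{k+1}(t)`; recorded as the weaker
`Λ_{k+1}(t) ⊆ Λ_k` face with three layers on `Ω_{k+1}(t)` being the operative statement. [cite: Balaban1988Convergent, (2.1) p.254, (3.20) p.269] -/
theorem LambdaOfLabel_subset_Λ (hk : 1 ≤ k) (s : SeqOfRecord F ν M g p.K k) (t : LbOfRecord F ν p g k) :
    LambdaOfLabel F ν M p g k s t ⊆ s.Λ k :=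
  (LambdaOfLabel_subset F ν M p g k s t).trans (OmegaOfLabel_subset_Λ F ν M p g k s t hk)

/-- **AT THE σ-IMAGE**: the sequence `σ s t = (…, Ω_{k+1}(t); …, Λ_{k+1}(t))` of the (3.5)∕(3.20) index map is separated at its top pair.
[cite: Balaban1988Convergent, p.256, (3.5) p.265, (3.20) p.269] -/
theorem hullD_σOfRecord_Ω_succ_subset_Λ (hk : 1 ≤ k) (s : SeqOfRecord F ν M g p.K k) (t : LbOfRecord F ν p g k) :
    hullD (F.P p.K) (sideD F ν M p g k) 3 ((σOfRecord F ν M p g k s t).Ω (k + 1)) ⊆ (σOfRecord F ν M p g k s t).Λ k := by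
  rw [σOfRecord_Ω_succ, ← Seq.init_Λ (σOfRecord F ν M p g k s t) hk le_rfl, init_σOfRecord]
  exact hullD_OmegaOfLabel_subset_Λ F ν M p g hk s t

end Geometry

/-! ## §3  Support of the resummed step weights and of the slots they generate -/

section Support

variable (F : T4Family) (N : ℕ) [NeZero N]

/-- **The kernel transport of record kills the zero integrand** (`integral_zero`). [cite: Balaban1988Convergent, (3.1) p.264 (bookkeeping)] -/
theorem transportOfRecord_eq_zero_of_forall {K k : ℕ} (ρ : Density (F.P K) k (SU N)) (h : ∀ U, ρ U = 0)
    (V : GaugeField (F.P K) (k + 1) (SU N)) : transportOfRecord F N K k ρ V = 0 := by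
  have hρ : ρ = fun _ => 0 := funext h
  rw [hρ]
  simp [transportOfRecord, T4AveragingDisintegration.transportK, T4AveragingDisintegration.kernelTransport]

variable (ν : Stage7Numerics) (τ : TowerNumerics) (E : B12.RunParams → ℝ) (w : StepWeightsOfRecord F N ν τ.M) (ppSel : PpSelOfRecord F ν τ.M)
  (p : B12.RunParams) (g : ℕ → ℝ) (k : ℕ)

/-- **A SEQUENCE WITH VANISHING STEP WEIGHT HAS THE ZERO 𝐓-SLOT** at level `k+1` (the (†) integrand is `w(s′)(U,V′)·χ_k·slot_k ≡ 0`).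
[cite: Balaban1988Convergent, (3.1) p.264, (3.24)–(3.25) p.270] -/
theorem slotsTOfRecord_succ_eq_zero_of_weights_eq_zero (s' : SeqOfRecord F ν τ.M g p.K (k + 1)) (hw : ∀ U V', w p g k s' U V' = 0) :
    slotsTOfRecord F N ν τ E w ppSel p g (k + 1) s' = 0 := by
  funext V'
  rw [slotsTOfRecord_succ, tstepOfRecord_apply, Pi.zero_apply]
  apply transportOfRecord_eq_zero_of_forall
  intro U
  rw [hw U V', zero_mul]

/-- **AN ABSENT PARENT HAS ABSENT CHILDREN** (pre-𝐑): `slot_k(init s′) = 0 ⇒ slotT_{k+1}(s′) = 0`. [cite: Balaban1988Convergent, (3.1) p.264, (3.24)–(3.25) p.270] -/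
theorem slotsTOfRecord_succ_eq_zero_of_init_eq_zero (s' : SeqOfRecord F ν τ.M g p.K (k + 1))
    (h0 : slotsOfRecord F N ν τ E w ppSel p g k s'.init = 0) :
    slotsTOfRecord F N ν τ E w ppSel p g (k + 1) s' = 0 := by
  funext V'
  rw [slotsTOfRecord_succ, tstepOfRecord_apply, Pi.zero_apply]
  apply transportOfRecord_eq_zero_of_forall
  intro U
  rw [h0, Pi.zero_apply, mul_zero, mul_zero]

/-- **AN ABSENT 𝐓-SLOT GIVES AN ABSENT POST-𝐑 SLOT** (def-R's `rstepSlotOfRecord_eq_zero_of_eq_zero`; ANY selector, NO proviso).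
[cite: Balaban1989LargeFieldI, (0.3) p.176; Balaban1988Convergent, (3.24) p.270] -/
theorem slotsOfRecord_succ_eq_zero_of_slotsT_eq_zero (s' : SeqOfRecord F ν τ.M g p.K (k + 1))
    (h0 : slotsTOfRecord F N ν τ E w ppSel p g (k + 1) s' = 0) :
    slotsOfRecord F N ν τ E w ppSel p g (k + 1) s' = 0 := by
  funext V
  rw [slotsOfRecord_succ]
  exact rstepSlotOfRecord_eq_zero_of_eq_zero ν τ ppSel p _ (k + 1) _ s' h0 V

/-- **A PRESENT POST-𝐑 SLOT HAS A PRESENT PARENT**: `slot_{k+1}(s′) ≠ 0 ⇒ slot_k(init s′) ≠ 0`. [cite: Balaban1988Convergent, (3.24)–(3.25) p.270; Balaban1989LargeFieldI, (0.3) p.176] -/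
theorem slotsOfRecord_init_ne_zero_of_succ_ne_zero (s' : SeqOfRecord F ν τ.M g p.K (k + 1))
    (h : slotsOfRecord F N ν τ E w ppSel p g (k + 1) s' ≠ 0) : slotsOfRecord F N ν τ E w ppSel p g k s'.init ≠ 0 :=
  fun h0 => h (slotsOfRecord_succ_eq_zero_of_slotsT_eq_zero F N ν τ E w ppSel p g k s'
    (slotsTOfRecord_succ_eq_zero_of_init_eq_zero F N ν τ E w ppSel p g k s' h0))

variable (A₁ : ℝ) (ζ : ZetaOfRecord F N ν τ.M)

/-- **THE RESUMMED STEP WEIGHT VANISHES OFF THE RANGE OF THE INDEX MAP**: if no label `t` has `σ (init s′) t = s′`, then `w(s′)(U,V′) = 0` — the fibre of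
`resumWeights` over `s′` is empty. [cite: Balaban1988Convergent, (3.2)–(3.5) p.265, (3.16) p.268, (3.20) p.269, §3 p.267] -/
theorem wOfRecord_eq_zero_of_forall_σ_ne (s' : SeqOfRecord F ν τ.M g p.K (k + 1)) (h : ∀ t, σOfRecord F ν τ.M p g k s'.init t ≠ s')
    (U : GaugeField (F.P p.K) k (SU N)) (V' : GaugeField (F.P p.K) (k + 1) (SU N)) :
    wOfRecord F N ν τ.M A₁ ζ p g k s' U V' = 0 := by
  classical
  rw [wOfRecord_apply]
  unfold resumWeights
  refine Finset.sum_eq_zero fun t ht => ?_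
  simp only [Finset.mem_filter, Finset.mem_univ, true_and] at ht
  exact absurd ht (h t)

/-- **THE 𝐓-SLOT OF A SEQUENCE NOT PRODUCED BY (3.5)∕(3.20) IS IDENTICALLY ZERO.** [cite: Balaban1988Convergent, (3.1) p.264, (3.5) p.265, (3.20) p.269, (3.24)–(3.25) p.270] -/
theorem slotsTOfRecord_succ_eq_zero_of_forall_σ_ne (s' : SeqOfRecord F ν τ.M g p.K (k + 1))
    (h : ∀ t, σOfRecord F ν τ.M p g k s'.init t ≠ s') :
    slotsTOfRecord F N ν τ E (wOfRecord F N ν τ.M A₁ ζ) ppSel p g (k + 1) s' = 0 :=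
  slotsTOfRecord_succ_eq_zero_of_weights_eq_zero F N ν τ E _ ppSel p g k s'
    (wOfRecord_eq_zero_of_forall_σ_ne F N ν τ p g k A₁ ζ s' h)

/-- **… AND SO IS ITS POST-𝐑 SLOT** (any selector). [cite: Balaban1989LargeFieldI, (0.3) p.176; Balaban1988Convergent, (3.5) p.265, (3.24) p.270] -/
theorem slotsOfRecord_succ_eq_zero_of_forall_σ_ne (s' : SeqOfRecord F ν τ.M g p.K (k + 1))
    (h : ∀ t, σOfRecord F ν τ.M p g k s'.init t ≠ s') :
    slotsOfRecord F N ν τ E (wOfRecord F N ν τ.M A₁ ζ) ppSel p g (k + 1) s' = 0 :=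
  slotsOfRecord_succ_eq_zero_of_slotsT_eq_zero F N ν τ E _ ppSel p g k s'
    (slotsTOfRecord_succ_eq_zero_of_forall_σ_ne F N ν τ E ppSel p g k A₁ ζ s' h)

/-- **A PRESENT POST-𝐑 SLOT IS PRODUCED BY THE INDEX MAP**: `slot_{k+1}(s′) ≠ 0 ⇒ ∃ t, σ (init s′) t = s′`. [cite: Balaban1988Convergent, (3.5) p.265, (3.20) p.269, §3 p.267] -/
theorem exists_label_of_slotsOfRecord_succ_ne_zero (s' : SeqOfRecord F ν τ.M g p.K (k + 1))
    (h : slotsOfRecord F N ν τ E (wOfRecord F N ν τ.M A₁ ζ) ppSel p g (k + 1) s' ≠ 0) :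
    ∃ t, σOfRecord F ν τ.M p g k s'.init t = s' := by
  by_contra hne
  exact h (slotsOfRecord_succ_eq_zero_of_forall_σ_ne F N ν τ E ppSel p g k A₁ ζ s' fun t ht => hne ⟨t, ht⟩)

/-- **A PRESENT 𝐓-SLOT IS PRODUCED BY THE INDEX MAP**: `slotT_{k+1}(s′) ≠ 0 ⇒ ∃ t, σ (init s′) t = s′`. [cite: Balaban1988Convergent, (3.5) p.265, (3.20) p.269, §3 p.267] -/
theorem exists_label_of_slotsTOfRecord_succ_ne_zero (s' : SeqOfRecord F ν τ.M g p.K (k + 1))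
    (h : slotsTOfRecord F N ν τ E (wOfRecord F N ν τ.M A₁ ζ) ppSel p g (k + 1) s' ≠ 0) :
    ∃ t, σOfRecord F ν τ.M p g k s'.init t = s' := by
  by_contra hne
  exact h (slotsTOfRecord_succ_eq_zero_of_forall_σ_ne F N ν τ E ppSel p g k A₁ ζ s' fun t ht => hne ⟨t, ht⟩)

end Support

/-! ## §4  ★★ Every sequence charged by a density of record is separated at every consecutive pair -/

section Separated

variable (F : T4Family) (N : ℕ) [NeZero N] (ν : Stage7Numerics) (τ : TowerNumerics) (E : B12.RunParams → ℝ) (A₁ : ℝ) (ζ : ZetaOfRecord F N ν τ.M)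
  (ppSel : PpSelOfRecord F ν τ.M) (p : B12.RunParams) (g : ℕ → ℝ)

/-- **★★ A SEQUENCE WITH A NON-ZERO POST-𝐑 SLOT OF RECORD IS ADMISSIBLE WITH SEPARATED BOUNDARIES**: if `slot_k(s) ≠ 0` (as a function) then for every
`1 ≤ j < k` three layers of 𝐃_{j+1}-cubes around `Ω_{j+1}(s)` lie inside `Λ_j(s)` — induction over the history: a present slot has a present parent and is the
σ-image of it (§3), whose top pair is separated (§2); lower pairs by the parent.  POINTWISE (no a.e.), NO proviso, ANY selector `ppSel`, ANY `E`, `A₁`, `ζ`, run,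
history.  This is the representation-side home of print's «admissible sequences»: the (2.18) sum of record charges only them. [cite: Balaban1988Convergent, (2.1) p.254, p.256, (2.18) p.257, (3.5) p.265, (3.20) p.269, (3.24)–(3.25) p.270; Balaban1989LargeFieldI, (0.3) p.176] -/
theorem separated_of_slotsOfRecord_ne_zero :
    ∀ (k : ℕ) (s : SeqOfRecord F ν τ.M g p.K k), slotsOfRecord F N ν τ E (wOfRecord F N ν τ.M A₁ ζ) ppSel p g k s ≠ 0 →
      ∀ j, 1 ≤ j → j < k → hullD (F.P p.K) (sideD F ν τ.M p g j) 3 (s.Ω (j + 1)) ⊆ s.Λ j := by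
  intro k
  induction k with
  | zero => exact fun _ _ j _ hj => absurd hj (Nat.not_lt_zero j)
  | succ k ih =>
    intro s' hs' j h1 hj
    obtain ⟨t, ht⟩ := exists_label_of_slotsOfRecord_succ_ne_zero F N ν τ E ppSel p g k A₁ ζ s' hs'
    have hpar := slotsOfRecord_init_ne_zero_of_succ_ne_zero F N ν τ E (wOfRecord F N ν τ.M A₁ ζ) ppSel p g k s' hs'
    rcases (Nat.lt_succ_iff.1 hj).eq_or_lt with rfl | hjk
    · rw [← ht]
      exact hullD_σOfRecord_Ω_succ_subset_Λ F ν τ.M p g h1 s'.init t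
    · rw [← Seq.init_Ω s' (Nat.le_succ_of_le h1) hjk, ← Seq.init_Λ s' h1 hjk.le]
      exact ih s'.init hpar j h1 hjk

/-- **The same for the PRE-𝐑 slots** (`slotT_k(s) ≠ 0`, `k ≥ 1`: a present 𝐓-slot is a σ-image with a present post-𝐑 parent).
[cite: Balaban1988Convergent, (2.1) p.254, p.256, (3.5) p.265, (3.20) p.269, (3.24)–(3.25) p.270] -/
theorem separated_of_slotsTOfRecord_succ_ne_zero (k : ℕ) (s' : SeqOfRecord F ν τ.M g p.K (k + 1))
    (hs' : slotsTOfRecord F N ν τ E (wOfRecord F N ν τ.M A₁ ζ) ppSel p g (k + 1) s' ≠ 0) :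
    ∀ j, 1 ≤ j → j < k + 1 → hullD (F.P p.K) (sideD F ν τ.M p g j) 3 (s'.Ω (j + 1)) ⊆ s'.Λ j := by
  intro j h1 hj
  obtain ⟨t, ht⟩ := exists_label_of_slotsTOfRecord_succ_ne_zero F N ν τ E ppSel p g k A₁ ζ s' hs'
  have hpar : slotsOfRecord F N ν τ E (wOfRecord F N ν τ.M A₁ ζ) ppSel p g k s'.init ≠ 0 :=
    fun h0 => hs' (slotsTOfRecord_succ_eq_zero_of_init_eq_zero F N ν τ E _ ppSel p g k s' h0)
  rcases (Nat.lt_succ_iff.1 hj).eq_or_lt with rfl | hjk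
  · rw [← ht]
    exact hullD_σOfRecord_Ω_succ_subset_Λ F ν τ.M p g h1 s'.init t
  · rw [← Seq.init_Ω s' (Nat.le_succ_of_le h1) hjk, ← Seq.init_Λ s' h1 hjk.le]
    exact separated_of_slotsOfRecord_ne_zero F N ν τ E A₁ ζ ppSel p g k s'.init hpar j h1 hjk

/-- **POINT FORM**: a post-𝐑 slot that is non-zero AT ONE FIELD already forces the separation of its sequence. [cite: Balaban1988Convergent, p.256, (2.18) p.257, (3.5) p.265] -/
theorem separated_of_slotsOfRecord_apply_ne_zero (k : ℕ) (s : SeqOfRecord F ν τ.M g p.K k) (V : GaugeField (F.P p.K) k (SU N))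
    (hV : slotsOfRecord F N ν τ E (wOfRecord F N ν τ.M A₁ ζ) ppSel p g k s V ≠ 0) :
    ∀ j, 1 ≤ j → j < k → hullD (F.P p.K) (sideD F ν τ.M p g j) 3 (s.Ω (j + 1)) ⊆ s.Λ j :=
  separated_of_slotsOfRecord_ne_zero F N ν τ E A₁ ζ ppSel p g k s fun h0 => hV (by rw [h0]; rfl)

/-- **CONTRAPOSITIVE**: a sequence that FAILS the three-layer separation at some consecutive pair carries the ZERO post-𝐑 slot of record — it is absent from
the (2.18) sum of `ρ_k` at every field. [cite: Balaban1988Convergent, p.256, (2.18) p.257, (3.5) p.265, (3.24) p.270] -/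
theorem slotsOfRecord_eq_zero_of_not_separated (k : ℕ) (s : SeqOfRecord F ν τ.M g p.K k) {j : ℕ} (h1 : 1 ≤ j) (hj : j < k)
    (hns : ¬ hullD (F.P p.K) (sideD F ν τ.M p g j) 3 (s.Ω (j + 1)) ⊆ s.Λ j) :
    slotsOfRecord F N ν τ E (wOfRecord F N ν τ.M A₁ ζ) ppSel p g k s = 0 := by
  by_contra h
  exact hns (separated_of_slotsOfRecord_ne_zero F N ν τ E A₁ ζ ppSel p g k s h j h1 hj)

end Separated

/-! ## §5  At node00-def-T's Stage-13 record (`EOfRecord₁₃`, `wOfRecord₉`, `θ.ppSel`, `gOfRecord₁₃`), BY NAME -/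

section Record13

variable (F : T4Family) (N : ℕ) [NeZero N] (θ : Stage13Params F N) (p : B12.RunParams)

/-- **★★ AT THE STAGE-13 RECORD: EVERY SEQUENCE WITH A NON-ZERO SLOT OF `ρ_k` IS SEPARATED AT EVERY CONSECUTIVE PAIR** (three 𝐃_{j+1}-layers, `1 ≤ j < k`), for
every `θ : Stage13Params` and run — no proviso, no admissibility, no selector clause. [cite: Balaban1988Convergent, (2.1) p.254, p.256, (2.18) p.257, (3.5) p.265, (3.20) p.269; Balaban1989LargeFieldI, (0.3) p.176] -/
theorem separated_of_slotsOfRecord₁₃_ne_zero (k : ℕ) (s : SeqOfRecord F θ.ν θ.τ9.M (gOfRecord₁₃ F N θ p) p.K k)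
    (hs : slotsOfRecord F N θ.ν θ.τ9 (EOfRecord₁₃ F N θ) (wOfRecord₉ F N θ.toStage9Params) θ.ppSel p (gOfRecord₁₃ F N θ p) k s ≠ 0) :
    ∀ j, 1 ≤ j → j < k → hullD (F.P p.K) (sideD F θ.ν θ.τ9.M p (gOfRecord₁₃ F N θ p) j) 3 (s.Ω (j + 1)) ⊆ s.Λ j :=
  separated_of_slotsOfRecord_ne_zero F N θ.ν θ.τ9 (EOfRecord₁₃ F N θ) θ.A₁ θ.ζ θ.ppSel p (gOfRecord₁₃ F N θ p) k s hs

/-- **The same for the pre-𝐑 slots `slotT_{k+1}` of `𝐓ρ_k` at the record.** [cite: Balaban1988Convergent, (2.1) p.254, p.256, (3.5) p.265, (3.24)–(3.25) p.270] -/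
theorem separated_of_slotsTOfRecord₁₃_succ_ne_zero (k : ℕ) (s' : SeqOfRecord F θ.ν θ.τ9.M (gOfRecord₁₃ F N θ p) p.K (k + 1))
    (hs' : slotsTOfRecord F N θ.ν θ.τ9 (EOfRecord₁₃ F N θ) (wOfRecord₉ F N θ.toStage9Params) θ.ppSel p (gOfRecord₁₃ F N θ p) (k + 1) s' ≠ 0) :
    ∀ j, 1 ≤ j → j < k + 1 → hullD (F.P p.K) (sideD F θ.ν θ.τ9.M p (gOfRecord₁₃ F N θ p) j) 3 (s'.Ω (j + 1)) ⊆ s'.Λ j :=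
  separated_of_slotsTOfRecord_succ_ne_zero F N θ.ν θ.τ9 (EOfRecord₁₃ F N θ) θ.A₁ θ.ζ θ.ppSel p (gOfRecord₁₃ F N θ p) k s' hs'

/-- **AT THE RECORD, A NON-SEPARATED SEQUENCE IS ABSENT FROM `ρ_k`** (zero slot, every field). [cite: Balaban1988Convergent, p.256, (2.18) p.257, (3.5) p.265] -/
theorem slotsOfRecord₁₃_eq_zero_of_not_separated (k : ℕ) (s : SeqOfRecord F θ.ν θ.τ9.M (gOfRecord₁₃ F N θ p) p.K k) {j : ℕ} (h1 : 1 ≤ j)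
    (hj : j < k) (hns : ¬ hullD (F.P p.K) (sideD F θ.ν θ.τ9.M p (gOfRecord₁₃ F N θ p) j) 3 (s.Ω (j + 1)) ⊆ s.Λ j) :
    slotsOfRecord F N θ.ν θ.τ9 (EOfRecord₁₃ F N θ) (wOfRecord₉ F N θ.toStage9Params) θ.ppSel p (gOfRecord₁₃ F N θ p) k s = 0 :=
  slotsOfRecord_eq_zero_of_not_separated F N θ.ν θ.τ9 (EOfRecord₁₃ F N θ) θ.A₁ θ.ζ θ.ppSel p (gOfRecord₁₃ F N θ p) k s h1 hj hns

/-- **… HENCE DEAD at the next step** (its 𝐓-term has zero fibre mass everywhere: `…B16RLeafRecord13Live` §1's currency), so on the live line it is moved only onto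
itself or dropped — never charged. [cite: Balaban1989LargeFieldI, (0.3) p.176, p.177 (i)–(ii); Balaban1988Convergent, p.256, (3.24)–(3.25) p.270] -/
theorem fibreIntegral_termT₁₃_eq_zero_of_not_separated (k : ℕ) (s' : SeqOfRecord F θ.ν θ.τ9.M (gOfRecord₁₃ F N θ p) p.K (k + 1)) {j : ℕ}
    (h1 : 1 ≤ j) (hj : j < k + 1) (hns : ¬ hullD (F.P p.K) (sideD F θ.ν θ.τ9.M p (gOfRecord₁₃ F N θ p) j) 3 (s'.Ω (j + 1)) ⊆ s'.Λ j)
    (V : GaugeField (F.P p.K) (k + 1) (SU N)) :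
    B15.BasicStep.fibreIntegral (fibOfSeq F θ.ν θ.τ9 p (gOfRecord₁₃ F N θ p) (k + 1) s')
        (rterm (sliceOfRecord F N θ.ν θ.τ9.M p (gOfRecord₁₃ F N θ p) (k + 1)
          (slotsTOfRecord F N θ.ν θ.τ9 (EOfRecord₁₃ F N θ) (wOfRecord₉ F N θ.toStage9Params) θ.ppSel p (gOfRecord₁₃ F N θ p) (k + 1))) s') V = 0 := by
  refine B16RLeafRecord13Live.fibreIntegral_termT₁₃_eq_zero_of_slotsT_eq_zero F N θ p k s' ?_ V
  by_contra h
  exact hns (separated_of_slotsTOfRecord₁₃_succ_ne_zero F N θ p k s' h j h1 hj)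

end Record13

/-! ## §6  THE BRIDGE TO node00-def-P11's `Sect2.SeqSeparated` (ONE layer of `L^{n+1}M₁`-cubes, r11's `enl` on the cover): a present sequence is
print-separated in THAT predicate whenever the `L^{n+1}M₁`-cubes are not larger than the 𝐃_{n+1}-cubes of record (`L^{n+1}M₁ ≤ L^{n+1}·M·R_{n+1}`, displayed) -/

section Bridge

variable {P : Params}

/-- Interval bookkeeping behind `enlT_one_subset_hullD_three`. [folklore] -/
private theorem bridge_bound {σ₁ σD A l u y Nv : ℤ} (hAl : A ≤ l) (hlA : l < A + σD) (hw₁ : -(2 * σ₁ - 1) ≤ u - y) (hw₂ : u - y ≤ 2 * σ₁ - 1)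
    (hv : l = u + Nv) (hle : σ₁ ≤ σD) :
    A - 3 * σD ≤ y + Nv ∧ y + Nv ≤ A + σD - 1 + 3 * σD := by
  constructor <;> linarith

/-- The standard-section representative of a torus site indexes a cube of def-R's grid family (`0 < s`). [cite: Balaban1988Convergent, (2.17) p.257 (bookkeeping: the cube partition)] -/
private theorem cubeIdx_lift_mem_cubeIndices {s : ℕ} (hs : 0 < s) (c : Site P 0) : cubeIdx s (lift P c) ∈ cubeIndices P s := by
  unfold cubeIndices
  rw [Fintype.mem_piFinset]
  intro i
  rw [Finset.mem_image]
  refine ⟨(c i).val / s, ?_, ?_⟩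
  · rw [Finset.mem_range]
    have hv : (c i).val < P.sitesPerDir 0 := ZMod.val_lt _
    have h1 : (c i).val / s ≤ (P.sitesPerDir 0 - 1) / s := Nat.div_le_div_right (by omega)
    have h2 : (P.sitesPerDir 0 + s - 1) / s = (P.sitesPerDir 0 - 1) / s + 1 := by
      rw [show P.sitesPerDir 0 + s - 1 = (P.sitesPerDir 0 - 1) + s by omega, Nat.add_div_right _ hs]
    omega
  · unfold cubeIdx lift
    simp only [Int.natCast_ediv]

/-- A torus site lies in the grid cube of its standard-section representative. [cite: Balaban1988Convergent, (2.17) p.257 (bookkeeping: the cube partition)] -/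
private theorem mem_cubeEnl_cubeIdx_lift {s : ℕ} (hs : 0 < s) (c : Site P 0) : c ∈ cubeEnl P s (cubeIdx s (lift P c)) 0 := by
  refine ⟨lift P c, fun i => ?_, cover_lift c⟩
  have h1 := cubeIdx_le s hs (lift P c) i
  have h2 := lt_cubeIdx s hs (lift P c) i
  simp only [Nat.zero_mul, Nat.cast_zero, sub_zero, add_zero]
  exact ⟨h1, by linarith⟩

/-- **TWO ENLARGEMENT DICTIONARIES COMPARED**: one layer of `σ₁`-cubes in r11's cover-side sense (`Sect2.enlT P σ₁ 1`, the currency of node00-def-P11's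
`Sect2.SeqSeparated`) lies inside three layers of `σD`-cubes in def-T's grid sense (`hullD P σD 3`) as soon as `σ₁ ≤ σD` (`0 < σ₁`): a point whose `σ₁`-cube touches a
`σ₁`-cube meeting `Y` is within sup-distance `2σ₁ − 1 ≤ 3σD` of `Y`, read in the `σD`-cube of its standard representative. [cite: Balaban1988Convergent, (2.1) p.254, p.256, p.264–265; Balaban1987RG1, p.257 (the `∼n` calculus)] -/
theorem enlT_one_subset_hullD_three {σ₁ σD : ℕ} (h₁ : 0 < σ₁) (hle : σ₁ ≤ σD) (Y : Set (Site P 0)) :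
    Sect2.enlT P σ₁ 1 Y ⊆ hullD P σD 3 Y := by
  have hD : 0 < σD := lt_of_lt_of_le h₁ hle
  rintro z ⟨u, ⟨y', hy'Y, hnear⟩, rfl⟩
  have hw : Within ((((1 : ℕ) : ℤ) + 1) * σ₁ - 1) u y' := within_of_idxNear σ₁ 1 h₁ hnear
  obtain ⟨v, hv⟩ := (cover_eq_cover_iff u (lift P (cover P u))).1 (cover_lift (cover P u)).symm
  refine mem_hullD_iff.2 ⟨cubeIdx σD (lift P (cover P u)), cubeIdx_lift_mem_cubeIndices hD (cover P u),
    ⟨cover P y', ⟨y' + pmul (per P) v, fun i => ?_, by rw [cover_add_pmul]⟩, hy'Y⟩, mem_cubeEnl_cubeIdx_lift hD (cover P u)⟩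
  have hA := cubeIdx_le σD hD (lift P (cover P u)) i
  have hB := lt_cubeIdx σD hD (lift P (cover P u)) i
  have hwi := abs_le.1 (hw i)
  have hvi : lift P (cover P u) i = u i + pmul (per P) v i := by rw [hv]; rfl
  have hle' : (σ₁ : ℤ) ≤ σD := by exact_mod_cast hle
  have hcast : (((3 * σD : ℕ)) : ℤ) = 3 * (σD : ℤ) := by push_cast; ring
  rw [hcast, Pi.add_apply]
  have h2 : (((1 : ℕ) : ℤ) + 1) * (σ₁ : ℤ) - 1 = 2 * σ₁ - 1 := by push_cast; ring
  rw [h2] at hwi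
  exact bridge_bound hA hB hwi.1 hwi.2 hvi hle'

variable (F : T4Family) (N : ℕ) [NeZero N] (ν : Stage7Numerics) (τ : TowerNumerics) (E : B12.RunParams → ℝ) (A₁ : ℝ) (ζ : ZetaOfRecord F N ν τ.M)
  (ppSel : PpSelOfRecord F ν τ.M) (p : B12.RunParams) (g : ℕ → ℝ)

/-- **THREE 𝐃-LAYERS ⇒ PRINT'S SEPARATION IN node00-def-P11's PREDICATE**, under the displayed grid comparison `0 < L^{j+1}M₁ ≤ sideD … j` (= `L^{j+1}·M·R_{j+1}`) at
every level `1 ≤ j < k` (and `Λ_j ⊆ Ω_j`). [cite: Balaban1988Convergent, (2.1) p.254, p.256; Balaban1985RegularSpaces, (1.3)–(1.6) p.77] -/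
theorem seqSeparated_of_hullD {k : ℕ} (s : SeqOfRecord F ν τ.M g p.K k)
    (hM : ∀ j, 1 ≤ j → j < k → 0 < side (F.P p.K).L ν.M₁ (j + 1) ∧ side (F.P p.K).L ν.M₁ (j + 1) ≤ sideD F ν τ.M p g j)
    (hsep : ∀ j, 1 ≤ j → j < k → hullD (F.P p.K) (sideD F ν τ.M p g j) 3 (s.Ω (j + 1)) ⊆ s.Λ j) :
    Sect2.SeqSeparated ν.M₁ s := by
  intro j h1 hj
  exact ((enlT_one_subset_hullD_three (hM j h1 hj).1 (hM j h1 hj).2 (s.Ω (j + 1))).trans (hsep j h1 hj)).trans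
    (s.chain.Λ_subset j h1 hj.le)

/-- **★★ EVERY SEQUENCE CHARGED BY A DENSITY OF RECORD IS PRINT-SEPARATED (`Sect2.SeqSeparated`)** — §4 read in node00-def-P11's predicate, under the displayed grid
comparison `0 < L^{j+1}M₁ ≤ L^{j+1}·M·R_{j+1}` (`1 ≤ j < k`): the representation-side complement of the support guard on row P11 — the (2.18) sum of record charges
only the sequences for which [15] Theorem 1 is printed. [cite: Balaban1988Convergent, (2.1) p.254, p.256, (2.18) p.257, (3.5) p.265; Balaban1985RegularSpaces, (1.3)–(1.6) p.77; Balaban1985Variational, Thm 1 p.279 (range)] -/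
theorem seqSeparated_of_slotsOfRecord_ne_zero {k : ℕ} (s : SeqOfRecord F ν τ.M g p.K k)
    (hM : ∀ j, 1 ≤ j → j < k → 0 < side (F.P p.K).L ν.M₁ (j + 1) ∧ side (F.P p.K).L ν.M₁ (j + 1) ≤ sideD F ν τ.M p g j)
    (hs : slotsOfRecord F N ν τ E (wOfRecord F N ν τ.M A₁ ζ) ppSel p g k s ≠ 0) : Sect2.SeqSeparated ν.M₁ s :=
  seqSeparated_of_hullD F ν τ p g s hM (separated_of_slotsOfRecord_ne_zero F N ν τ E A₁ ζ ppSel p g k s hs)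

/-- **CONTRAPOSITIVE in def-P11's predicate**: a non-separated sequence carries the zero slot of record (under the grid comparison). [cite: Balaban1988Convergent, p.256, (2.18) p.257, (3.5) p.265] -/
theorem slotsOfRecord_eq_zero_of_not_seqSeparated {k : ℕ} (s : SeqOfRecord F ν τ.M g p.K k)
    (hM : ∀ j, 1 ≤ j → j < k → 0 < side (F.P p.K).L ν.M₁ (j + 1) ∧ side (F.P p.K).L ν.M₁ (j + 1) ≤ sideD F ν τ.M p g j)
    (hns : ¬ Sect2.SeqSeparated ν.M₁ s) : slotsOfRecord F N ν τ E (wOfRecord F N ν τ.M A₁ ζ) ppSel p g k s = 0 := by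
  by_contra h
  exact hns (seqSeparated_of_slotsOfRecord_ne_zero F N ν τ E A₁ ζ ppSel p g s hM h)

variable (θ : Stage13Params F N)

/-- **★★ AT THE STAGE-13 RECORD, in def-P11's predicate**: every sequence with a non-zero slot of `ρ_k` is `Sect2.SeqSeparated θ.ν.M₁` (grid comparison displayed along the
₁₃ history) — so at every CHARGED sequence the support guard of the re-keyed row P11 is no restriction. [cite: Balaban1988Convergent, (2.1) p.254, p.256, (2.18) p.257, (2.28) p.259, (3.5) p.265; Balaban1985RegularSpaces, (1.3)–(1.6) p.77] -/
theorem seqSeparated_of_slotsOfRecord₁₃_ne_zero {k : ℕ} (s : SeqOfRecord F θ.ν θ.τ9.M (gOfRecord₁₃ F N θ p) p.K k)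
    (hM : ∀ j, 1 ≤ j → j < k → 0 < side (F.P p.K).L θ.ν.M₁ (j + 1) ∧
      side (F.P p.K).L θ.ν.M₁ (j + 1) ≤ sideD F θ.ν θ.τ9.M p (gOfRecord₁₃ F N θ p) j)
    (hs : slotsOfRecord F N θ.ν θ.τ9 (EOfRecord₁₃ F N θ) (wOfRecord₉ F N θ.toStage9Params) θ.ppSel p (gOfRecord₁₃ F N θ p) k s ≠ 0) :
    Sect2.SeqSeparated θ.ν.M₁ s :=
  seqSeparated_of_slotsOfRecord_ne_zero F N θ.ν θ.τ9 (EOfRecord₁₃ F N θ) θ.A₁ θ.ζ θ.ppSel p (gOfRecord₁₃ F N θ p) s hM hs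

/-! ### §6b  The grid comparison DISCHARGED: `1 ≤ R_{j+1}` always, so `M₁ ≤ M·R_{j+1}` at every numerics with `M₁ ≤ M` — in particular at K0a's witnesses
(`M₁ = M = 1`) -/

/-- **(2.5)'s `R_k ≥ 1`** (def-R's `RkOfRecord L r g = L^{s}` on the printed branch, `1` on the junk branch). [cite: Balaban1988Convergent, (2.5) p.255 (bookkeeping)] -/
theorem one_le_RkOfRecord {L : ℕ} (hL : 1 ≤ L) (r : ℕ) (g : ℝ) : 1 ≤ RkOfRecord L r g := by
  unfold RkOfRecord
  split_ifs with h
  · exact Nat.one_le_pow _ _ hL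
  · exact le_rfl

/-- **THE GRID COMPARISON FROM `0 < M₁ ≤ M·R_{j+1}`**: `0 < L^{j+1}M₁ ≤ L^{j+1}·M·R_{j+1} = sideD … j`. [cite: Balaban1988Convergent, (2.1) p.254, (2.5) p.255, p.264 (bookkeeping)] -/
theorem gridClause_of_M₁_le (j : ℕ) (hM₁ : 0 < ν.M₁) (hle : ν.M₁ ≤ τ.M * RkOfRecord (F.P p.K).L ν.r (g (j + 1))) :
    0 < side (F.P p.K).L ν.M₁ (j + 1) ∧ side (F.P p.K).L ν.M₁ (j + 1) ≤ sideD F ν τ.M p g j := by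
  have hL : 0 < (F.P p.K).L := by rw [T4Family.P_L]; exact lt_trans Nat.zero_lt_one F.hL.2
  constructor
  · unfold side
    exact Nat.mul_pos (pow_pos hL _) hM₁
  · unfold side sideD dCubeSide
    rw [mul_assoc]
    exact Nat.mul_le_mul_left _ hle

/-- **… in particular from `0 < M₁ ≤ M`** (any `L ≥ 1` family, every level, every history). [cite: Balaban1988Convergent, (2.1) p.254, (2.5) p.255 (bookkeeping)] -/
theorem gridClause_of_M₁_le_M (j : ℕ) (hM₁ : 0 < ν.M₁) (hle : ν.M₁ ≤ τ.M) :
    0 < side (F.P p.K).L ν.M₁ (j + 1) ∧ side (F.P p.K).L ν.M₁ (j + 1) ≤ sideD F ν τ.M p g j := by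
  refine gridClause_of_M₁_le F ν τ p g j hM₁ (hle.trans ?_)
  have hL : 1 ≤ (F.P p.K).L := by rw [T4Family.P_L]; exact le_of_lt F.hL.2
  calc τ.M = τ.M * 1 := (mul_one _).symm
    _ ≤ τ.M * RkOfRecord (F.P p.K).L ν.r (g (j + 1)) := Nat.mul_le_mul_left _ (one_le_RkOfRecord hL _ _)

/-- **★★ AT EVERY STAGE-13 PARAMETER WITH `0 < M₁ ≤ M` (K0a's witnesses: `M₁ = M = 1`): every sequence charged by `ρ_k` of record is `Sect2.SeqSeparated θ.ν.M₁`,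
NO FURTHER CLAUSE.** [cite: Balaban1988Convergent, (2.1) p.254, p.256, (2.18) p.257, (3.5) p.265; Balaban1985RegularSpaces, (1.3)–(1.6) p.77] -/
theorem seqSeparated_of_slotsOfRecord₁₃_ne_zero_of_M₁_le_M (hM₁ : 0 < θ.ν.M₁) (hle : θ.ν.M₁ ≤ θ.τ9.M) {k : ℕ}
    (s : SeqOfRecord F θ.ν θ.τ9.M (gOfRecord₁₃ F N θ p) p.K k)
    (hs : slotsOfRecord F N θ.ν θ.τ9 (EOfRecord₁₃ F N θ) (wOfRecord₉ F N θ.toStage9Params) θ.ppSel p (gOfRecord₁₃ F N θ p) k s ≠ 0) :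
    Sect2.SeqSeparated θ.ν.M₁ s :=
  seqSeparated_of_slotsOfRecord₁₃_ne_zero F N p θ s (fun j _ _ => gridClause_of_M₁_le_M F θ.ν θ.τ9 p (gOfRecord₁₃ F N θ p) j hM₁ hle) hs

/-- **★★★ AT THE WITNESS OF RECORD `θ₁₃ = theta13LiveOfRecord F N` — CLOSED**: every sequence with a non-zero slot of `ρ_k` is `Sect2.SeqSeparated` in node00-def-P11's
predicate (`M₁ = M = 1` of record). [cite: Balaban1988Convergent, (2.1) p.254, p.256, (2.18) p.257, (3.5) p.265; Balaban1985RegularSpaces, (1.3)–(1.6) p.77] -/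
theorem seqSeparated_of_slotsOfRecord₁₃_ne_zero_theta13LiveOfRecord {k : ℕ}
    (s : SeqOfRecord F (theta13LiveOfRecord F N).ν (theta13LiveOfRecord F N).τ9.M (gOfRecord₁₃ F N (theta13LiveOfRecord F N) p) p.K k)
    (hs : slotsOfRecord F N (theta13LiveOfRecord F N).ν (theta13LiveOfRecord F N).τ9 (EOfRecord₁₃ F N (theta13LiveOfRecord F N))
      (wOfRecord₉ F N (theta13LiveOfRecord F N).toStage9Params) (theta13LiveOfRecord F N).ppSel p
      (gOfRecord₁₃ F N (theta13LiveOfRecord F N) p) k s ≠ 0) :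
    Sect2.SeqSeparated (theta13LiveOfRecord F N).ν.M₁ s :=
  seqSeparated_of_slotsOfRecord₁₃_ne_zero_of_M₁_le_M F N p (theta13LiveOfRecord F N) (show 0 < 1 from Nat.one_pos) (show 1 ≤ 1 from le_rfl) s hs

/-- **★★ The same at K0a's [15]-keyed witnesses `θ₁₅ = theta13OfThm1 …` and `θ₁₅ᶜ = theta13OfThm1C …`** (`M₁ = M = 1` by the family's numerals), no clause.
[cite: Balaban1988Convergent, (2.1) p.254, p.256, (2.18) p.257, (3.5) p.265; Balaban1985RegularSpaces, (1.3)–(1.6) p.77; Balaban1985Variational, Thm 1 p.279 (range)] -/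
theorem seqSeparated_of_slotsOfRecord₁₃_ne_zero_theta13OfThm1 (ε₀ ε₂₉ B₃ a₀ a₁ : ℝ) {k : ℕ}
    (s : SeqOfRecord F (theta13OfThm1 F N ε₀ ε₂₉ B₃ a₀ a₁).ν (theta13OfThm1 F N ε₀ ε₂₉ B₃ a₀ a₁).τ9.M
      (gOfRecord₁₃ F N (theta13OfThm1 F N ε₀ ε₂₉ B₃ a₀ a₁) p) p.K k)
    (hs : slotsOfRecord F N (theta13OfThm1 F N ε₀ ε₂₉ B₃ a₀ a₁).ν (theta13OfThm1 F N ε₀ ε₂₉ B₃ a₀ a₁).τ9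
      (EOfRecord₁₃ F N (theta13OfThm1 F N ε₀ ε₂₉ B₃ a₀ a₁)) (wOfRecord₉ F N (theta13OfThm1 F N ε₀ ε₂₉ B₃ a₀ a₁).toStage9Params)
      (theta13OfThm1 F N ε₀ ε₂₉ B₃ a₀ a₁).ppSel p (gOfRecord₁₃ F N (theta13OfThm1 F N ε₀ ε₂₉ B₃ a₀ a₁) p) k s ≠ 0) :
    Sect2.SeqSeparated (theta13OfThm1 F N ε₀ ε₂₉ B₃ a₀ a₁).ν.M₁ s :=
  seqSeparated_of_slotsOfRecord₁₃_ne_zero_of_M₁_le_M F N p _ (show 0 < 1 from Nat.one_pos) (show 1 ≤ 1 from le_rfl) s hs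

/-- See `seqSeparated_of_slotsOfRecord₁₃_ne_zero_theta13OfThm1`; the `L`-keyed twin `θ₁₅ᶜ`. [cite: Balaban1988Convergent, (2.1) p.254, p.256, (2.18) p.257, (3.5) p.265; Balaban1985RegularSpaces, (1.3)–(1.6) p.77] -/
theorem seqSeparated_of_slotsOfRecord₁₃_ne_zero_theta13OfThm1C (ε₀ ε₂₉ B₃ a₀ a₁ : ℝ) {k : ℕ}
    (s : SeqOfRecord F (theta13OfThm1C F N ε₀ ε₂₉ B₃ a₀ a₁).ν (theta13OfThm1C F N ε₀ ε₂₉ B₃ a₀ a₁).τ9.M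
      (gOfRecord₁₃ F N (theta13OfThm1C F N ε₀ ε₂₉ B₃ a₀ a₁) p) p.K k)
    (hs : slotsOfRecord F N (theta13OfThm1C F N ε₀ ε₂₉ B₃ a₀ a₁).ν (theta13OfThm1C F N ε₀ ε₂₉ B₃ a₀ a₁).τ9
      (EOfRecord₁₃ F N (theta13OfThm1C F N ε₀ ε₂₉ B₃ a₀ a₁)) (wOfRecord₉ F N (theta13OfThm1C F N ε₀ ε₂₉ B₃ a₀ a₁).toStage9Params)
      (theta13OfThm1C F N ε₀ ε₂₉ B₃ a₀ a₁).ppSel p (gOfRecord₁₃ F N (theta13OfThm1C F N ε₀ ε₂₉ B₃ a₀ a₁) p) k s ≠ 0) :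
    Sect2.SeqSeparated (theta13OfThm1C F N ε₀ ε₂₉ B₃ a₀ a₁).ν.M₁ s :=
  seqSeparated_of_slotsOfRecord₁₃_ne_zero_of_M₁_le_M F N p _ (show 0 < 1 from Nat.one_pos) (show 1 ≤ 1 from le_rfl) s hs

end Bridge

end Literature.MathematicalPhysics.QuantumFieldTheory.Balaban1983to89.B14SeparationOfRecord
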